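import Literature.AnabelianGeometry.SemiGraphs.TemperedAnabelian
import Literature.AnabelianGeometry.SemiGraphs.TemperedGroups
import Literature.AnabelianGeometry.SemiGraphs.ProfiniteCompletionModel
import Literature.GroupTheory.CombinatorialGroupTheory.FreeGroupResiduallyFinite
import Mathlib.Topology.Algebra.Category.ProfiniteGrp.Completion
import Mathlib.GroupTheory.FreeGroup.GeneratorEquiv
import Mathlib.SetTheory.Cardinal.Free
import Mathlib.Logic.Equiv.Fin.Basic
import HarnessLib

/-!
# Non-vacuity of the "tempered + virtually free tower" hypotheses of [SemiAnbd] §6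

Mochizuki, *Semi-graphs of anabelioids*, Publ. RIMS **42** (2006) [SemiAnbd], §6 pp. 69–70, and
[André 2003, §4.5] (`π₁^temp = lim Δ_n`, "`Δ_n` is virtually free").
[cite: MochizukiSemiAnbd2006, §6 pp.69-70]

VACUITY-LANE companion (abc-iut cell, prover abc-iut-w5-d240; theorems only, no definitions).  The
tree's proofs of [SemiAnbd] Lemma 6.1 (iii) / 6.3 (ii) / 6.3 (iii) and hence of Theorems 6.4 / 6.6
(`TemperedAnabelianLem63iiProofs`, `TemperedAnabelianLem63iiiProofs`) are MODULO the structural inputs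

  (T) `IsTempered Π`,  (C) `IsProfiniteCompletion (ι : Π → Π̂)`,  (VF₀) the tower input `htower₀`:
  cofinally many open normal `N ⊴ Π` with `Π/N ⊇` a NON-ABELIAN free normal subgroup of finite index
  and finite rank.

This file kernel-checks that (T) ∧ (C) ∧ (VF₀) is SATISFIABLE by a non-profinite group — the discrete
free group of rank two with Mathlib's profinite completion — so that theorems carrying these hypotheses
are not vacuously true:

* `isTempered_of_discreteTopology` — a countable discrete group is tempered ([SemiAnbd] Def. 3.1 (i));
* (from `ProfiniteCompletionModel.lean`, abc-iut L3: `isProfiniteCompletion_toProfiniteCompletion` —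
  for a discrete group `F`, Mathlib's `η : F → F̂` satisfies L3's interface `IsProfiniteCompletion`);
* `tower_of_isFreeGroup` — a discrete non-abelian free group of finite rank satisfies (VF₀) (with
  `N = 1`);
* `tower_hypotheses_satisfiable` — the conjunction, at `FreeGroup (Fin 2)`, together with
  `¬ CompactSpace` (the witness is not profinite, unlike the degenerate inhabitant `G_{ℚ_p}` of
  `TemperedAnabelianWitness.lean`, which satisfies (T), (C) but NOT (VF₀)).

HONEST LIMITS: consistency evidence for the hypothesis shape only; the free group of rank two is not
the tempered fundamental group of a curve over a `p`-adic field (no Galois augmentation); joint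
satisfiability WITH the `TemperedCurve` interface axioms is a separate (product) witness.  Nothing here
concerns the disputed parts of inter-universal Teichmüller theory or takes a side on [IUTchIII]
Cor. 3.12.
-/

noncomputable section

namespace Literature.AnabelianGeometry.SemiGraphs

open CategoryTheory ProfiniteGrp ProfiniteGrp.ProfiniteCompletion
open _root_.Topology

universe u

section Discrete

variable {F : Type u} [Group F] [TopologicalSpace F] [DiscreteTopology F]

/-- **A countable discrete group is tempered** ([SemiAnbd] Def. 3.1 (i): it is the inverse limit of
the one-term system `F`): `1` is an open normal subgroup of countable index, it separates points, and a
compatible family of cosets is the family of cosets of its `N = 1` member.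
[cite: MochizukiSemiAnbd2006, Def 3.1(i) p.33] -/
theorem isTempered_of_discreteTopology [Countable F] : IsTempered F := by
  -- the trivial subgroup as an open normal subgroup
  let B : OpenNormalSubgroup F :=
    { toOpenSubgroup := ⟨⊥, isOpen_discrete _⟩, isNormal' := by infer_instance }
  have hB : B.toSubgroup = ⊥ := rfl
  have hBle : ∀ N : OpenNormalSubgroup F, B ≤ N := fun N y hy => by
    have hy1 : y = 1 := hy
    rw [hy1]
    exact one_mem _
  refine ⟨fun U hU => ⟨B, ?_, fun x hx => ?_⟩, fun g hg => ⟨B, fun h => hg h⟩, fun x hx => ?_⟩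
  · rw [hB]
    exact (QuotientGroup.quotientBot (G := F)).toEquiv.countable_iff.mpr inferInstance
  · have hx1 : x = 1 := hx
    rw [hx1]
    exact mem_of_mem_nhds hU
  · obtain ⟨g, hg⟩ := QuotientGroup.mk_surjective (x B)
    exact ⟨g, fun N => hx B N (hBle N) g hg.symm⟩

/-- **A discrete non-abelian free group of finite rank satisfies the tower input (VF₀)** with `N = 1`:
`F/1 ≅ F` is itself the required free normal subgroup of finite index.
[cite: MochizukiSemiAnbd2006, §6 p.69] -/
theorem tower_of_isFreeGroup [IsFreeGroup F] [Finite (IsFreeGroup.Generators F)]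
    (hab : ∃ a b : F, a * b ≠ b * a) :
    ∀ U ∈ 𝓝 (1 : F), ∃ N : OpenNormalSubgroup F, (N : Set F) ⊆ U ∧
      ∃ (G : Subgroup (F ⧸ N.toSubgroup)) (_ : IsFreeGroup G), G.Normal ∧ G.FiniteIndex ∧
        Finite (IsFreeGroup.Generators G) ∧ ∃ a ∈ G, ∃ b ∈ G, a * b ≠ b * a := by
  intro U hU
  obtain ⟨a, b, hab⟩ := hab
  let B : OpenNormalSubgroup F :=
    { toOpenSubgroup := ⟨⊥, isOpen_discrete _⟩, isNormal' := by infer_instance }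
  refine ⟨B, fun x hx => ?_, ?_⟩
  · have hx1 : x = 1 := hx
    rw [hx1]
    exact mem_of_mem_nhds hU
  -- `G := ⊤ ≤ F/1`, free via `⊤ ≃* F/1 ≃* F`
  let e : (⊤ : Subgroup (F ⧸ B.toSubgroup)) ≃* F :=
    Subgroup.topEquiv.trans (QuotientGroup.quotientBot (G := F))
  haveI hfree : IsFreeGroup (⊤ : Subgroup (F ⧸ B.toSubgroup)) := IsFreeGroup.ofMulEquiv e.symm
  have hfin : Finite (IsFreeGroup.Generators (⊤ : Subgroup (F ⧸ B.toSubgroup))) :=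
    Finite.of_equiv (IsFreeGroup.Generators F) (Equiv.ofFreeGroupEquiv
      ((IsFreeGroup.toFreeGroup F).symm.trans (e.symm.trans (IsFreeGroup.toFreeGroup _))))
  refine ⟨⊤, hfree, inferInstance, inferInstance, hfin, QuotientGroup.mk a, Subgroup.mem_top _,
    QuotientGroup.mk b, Subgroup.mem_top _, fun h => hab ?_⟩
  have h' : (QuotientGroup.mk (a * b) : F ⧸ (⊥ : Subgroup F)) = QuotientGroup.mk (b * a) := h
  have h2 : (a * b)⁻¹ * (b * a) ∈ (⊥ : Subgroup F) := QuotientGroup.eq.mp h'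
  rw [Subgroup.mem_bot] at h2
  exact inv_mul_eq_one.mp h2

end Discrete

/-- **The hypotheses (T) ∧ (C) ∧ (VF₀) of the tree's proofs of [SemiAnbd] Lemma 6.1 (iii) / 6.3 (ii)(iii)
(and Theorems 6.4, 6.6) are jointly satisfiable by a NON-compact group**: the discrete free group of
rank two with Mathlib's profinite completion.  Vacuity-lane certificate; not a curve.
[cite: MochizukiSemiAnbd2006, §6 pp.69-70] -/
theorem tower_hypotheses_satisfiable :
    ∃ (P : Type) (_ : Group P) (_ : TopologicalSpace P) (_ : IsTopologicalGroup P)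
      (Ph : Type) (_ : Group Ph) (_ : TopologicalSpace Ph) (_ : IsTopologicalGroup Ph)
      (ι : P →ₜ* Ph),
      IsTempered P ∧ IsProfiniteCompletion ι ∧ ¬ CompactSpace P ∧
      ∀ U ∈ 𝓝 (1 : P), ∃ N : OpenNormalSubgroup P, (N : Set P) ⊆ U ∧
        ∃ (G : Subgroup (P ⧸ N.toSubgroup)) (_ : IsFreeGroup G), G.Normal ∧ G.FiniteIndex ∧
          Finite (IsFreeGroup.Generators G) ∧ ∃ a ∈ G, ∃ b ∈ G, a * b ≠ b * a := by
  letI : TopologicalSpace (FreeGroup (Fin 2)) := ⊥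
  haveI : DiscreteTopology (FreeGroup (Fin 2)) := ⟨rfl⟩
  haveI : IsTopologicalGroup (FreeGroup (Fin 2)) := ⟨⟩
  haveI : Finite (IsFreeGroup.Generators (FreeGroup (Fin 2))) :=
    Finite.of_equiv (Fin 2) (Equiv.ofFreeGroupEquiv (IsFreeGroup.toFreeGroup (FreeGroup (Fin 2))))
  refine ⟨FreeGroup (Fin 2), inferInstance, inferInstance, inferInstance,
    completion (GrpCat.of (FreeGroup (Fin 2))), inferInstance, inferInstance, inferInstance,
    ⟨toProfiniteCompletion (FreeGroup (Fin 2)), continuous_of_discreteTopology⟩,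
    isTempered_of_discreteTopology, isProfiniteCompletion_toProfiniteCompletion (FreeGroup (Fin 2)), ?_,
    tower_of_isFreeGroup ⟨FreeGroup.of 0, FreeGroup.of 1, ?_⟩⟩
  · -- a compact discrete space is finite, but the free group of rank two is infinite
    intro hc
    haveI : Finite (FreeGroup (Fin 2)) := finite_of_compact_of_discrete
    exact not_finite (FreeGroup (Fin 2))
  · -- the two generators do not commute: map them to two non-commuting transpositions of `Fin 3`
    intro h
    let f : FreeGroup (Fin 2) →* Equiv.Perm (Fin 3) :=
      FreeGroup.lift ![Equiv.swap 0 1, Equiv.swap 1 2]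
    have h2 := congrArg f h
    simp only [map_mul, f, FreeGroup.lift_apply_of] at h2
    exact absurd h2 (by decide)

end Literature.AnabelianGeometry.SemiGraphs

end
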